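import Summits.AtomisticToContinuum.BoseEinsteinCondensation.Theses.BECHardSphereReduction
import Summits.AtomisticToContinuum.BoseEinsteinCondensation.Theorems.BECHardSphereReductionHardCoreDominatesContinuityAtHardCore
import Summits.AtomisticToContinuum.BoseEinsteinCondensation.Theorems.BECHardSphereReductionHardCoreDominatesDiniReduction
import Summits.AtomisticToContinuum.BoseEinsteinCondensation.Theorems.BECHardSphereReductionHardCoreDominatesOfDiniSign

/-!
# Skeleton v11 — crux `HardCoreDominates` (stmt-AtomisticToContinuum-11884) of route `BECHardSphereReduction`,
# line `birth` (payload slug `registered`): the coupling path to the hard core — the sign content in DINI form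

Lead c3, 2026-08-17 (v11; v10 = v9 re-owned, statements byte-identical: all provable stubs of the line LANDED — `stub_pathLsc` p154150,
`stub_diniGlue` p154590, their window-free combination `stub_localToGlobal` p155546; the open content is the ONE stub `stub_diniSign`,
the only `sorry` of this file; v10 adds nothing to the stub set — the window-free POINTWISE form of the composition,
`cn(HS_R) N L ≤ cn v N L` from the Dini sign at the single `(v, R, N, L)`, is landed separately in
`Theorems/BECHardSphereReductionHardCoreDominatesOfDiniSign.lean`). Fix `v` (measurable radial profile, `v r = 0` for `r > R`)
and put `v_t := v + t·1_{Iic R}` (`t : ℝ≥0`); `v_0 = v`, and the hard-sphere profile of the crux is the endpoint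
`HS_R = ⊤·1_{Iic R}`. Lead c1 landed the lower semicontinuity AT THE HARD CORE,
`cn(HS_R) ≤ liminf_{t→∞} cn(v_t)` (`stub_continuityAtHardCore`, p151033, from p143761 p144560 p146938 p147861
p149338), leaving ONE stub, `stub_covarianceSign` = antitonicity of `t ↦ cn(v_t) := condensateNumber v_t N L` on
`[0, ∞)` in a dilute window. v6 RESHAPES that stub into its provable envelope and its infinitesimal kernel:

* **`stub_pathLsc`** (LANDED p154150, `Theorems/BECHardSphereReductionHardCoreDominatesPathLsc.lean` — pure transfer of near-minimisers): `t ↦ cn(v_t)` is LOWER SEMICONTINUOUS at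
  every finite coupling `t₀`, at every `(N, L)`, for every `v` (no window, no measurability): the energy is affine
  in `t`, `energy v_t Ψ = energy v Ψ + t·∫ W_R |Ψ|²` with `0 ≤ ∫ W_R|Ψ|² ≤ N(N-1)/2`, so `δ`-near-minimisers of
  `v_t` are `(δ + N(N-1)|t-t₀|)`-near-minimisers of `v_{t₀}`;
* **`stub_diniGlue`** (LANDED p154590, `Theorems/BECHardSphereReductionHardCoreDominatesDiniGlue.lean` — real analysis, no physics): a pointwise-finite `g : ℝ≥0 → ℝ≥0∞` that is
  lower semicontinuous and has non-positive upper-right Dini derivative everywhere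
  (`∀ t ε>0 ∃ h₀>0 ∀ 0<h≤h₀, g(t+h) ≤ g t + ε h`) is antitone (apply the sup-argument to `g - ε·id` and let `ε → 0`);
* **`stub_localToGlobal`** (LANDED p155546, `Theorems/BECHardSphereReductionHardCoreDominatesDiniReduction.lean` — the
  window-free combination of the two at each fixed `(v, R, N, L)`: Dini sign at every coupling ⇒ antitone path; also
  `pathDominated_of_dini`, `condensateNumber_le_card`, `maxOccupation_le_card`, `condensateNumber_eq_top_of_isEmpty`);
* **`stub_diniSign`** (XL, OPEN — the only `sorry` of this file; the crux's sign content, SINGLE-COUPLING and infinitesimal): in a dilute window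
  `N·R³ ≤ η₀(v,R)·L³`, uniform along the ray, `D⁺_t cn(v_t) ≤ 0` at every `t`, typed in `ε-h₀` form. Its intended
  mechanism is the route's covariance identity `d/dt λ_max(γ_t) = -2⟨n̂_φ Ψ_t, R_⊥ W_R Ψ_t⟩ = -2∫₀^∞ Cov_s(n̂_φ, W_R) ds`
  (static response of the condensate occupation to the core overlap `W_R = Σ_{i<j} 1(|xᵢ-xⱼ| ≤ R)` in the ground
  state of `v_t`), whose sign is the bet of the route.

Composition (sorry-free): `covarianceSign_of_dini : Goal.stub_diniSign → (v5's stub_covarianceSign statement)` is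
`stub_localToGlobal` (= `stub_diniGlue` applied to `g t = cn(v_t)`, finite: `cn ≤ N` on an inhabited trial class,
`= ⊤` constant on an empty one, lsc by `stub_pathLsc`) inside the window; then
`HardCoreDominates_of (hD : Goal.stub_diniSign) : HardCoreDominates` (the open stub BY NAME) exactly as v5:
`η₀ := min η₁ η₂`, `cn(HS_R) ≤ liminf_t cn(v_t) ≤ cn(v_0) = cn(v)`.

Given `stub_pathLsc`, `stub_diniSign` is EQUIVALENT to v5's `stub_covarianceSign` (antitone ⇒ Dini trivially), so
the reshape loses nothing and registers the open content in its sharpest local form; the weaker sufficient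
residues (`∀ t, cn(v_t) ≤ cn(v)`; frequently in `t`) stay recorded sorry-free in `Lines/birth_residue.lean`.

History: v1 (planner, 2 stubs) → v2–v4 (lead c1: stub 2 ↦ five FA stubs, all landed) → v5 (one stub) → v6 (lead c2: three stubs)
→ v7 (pathLsc + diniGlue landed) → v8 (+ stub_localToGlobal registered) → v9 (localToGlobal landed p155546; one sorry)
→ v10 (lead c3: + `stub_condensateNumber_hardSphere_le_of_dini`, the pointwise composition, registered and proved; one sorry)
→ v11 (this: the pointwise composition LANDED p157832 `Theorems/BECHardSphereReductionHardCoreDominatesOfDiniSign.lean` and imported;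
`HardCoreDominates_of` is the landed `hardCoreDominates_of_diniSign`; one sorry = `stub_diniSign`).
Disproof used: no `Cruxes/HardCoreDominates/Disproof.lean` exists (checked 2026-08-17T10:00Z, `ledger crux ls`);
sibling `Theorems/HardCoreExtension/Negative/HighDensityObstruction.lean` (`not_condensateNumber_mono_potential`:
UNGUARDED upward monotonicity in the potential is false by packing) — `stub_diniSign` runs downward and carries the
dilute guard; `stub_pathLsc` is guard-free and direction-free (lsc, not usc: the fixed-box degeneracy junk of the
sibling `Cruxes/HardCoreExtension/Disproof.lean` §7 attacks usc only).
-/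

namespace Summit.AtomisticToContinuum.BoseEinsteinCondensation.Cruxes.HardCoreDominates.Birth

open Literature.MathematicalPhysics.QuantumManyBody.BoseGas

/-! ## Audit name of the open stub (hypothesis of `HardCoreDominates_of` BY NAME) -/

namespace Goal

/-- Statement of the XL stub `stub_diniSign` (verbatim). -/
abbrev stub_diniSign : Prop :=
  ∀ (v : ℝ → ENNReal) (R : ℝ), Measurable v → 0 < R → (∀ r : ℝ, R < r → v r = 0) →
    ∃ η₀ : ℝ, 0 < η₀ ∧ ∀ (N : ℕ) (L : ℝ), (N : ℝ) * R ^ 3 ≤ η₀ * L ^ 3 →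
      ∀ (t : NNReal) (ε : NNReal), 0 < ε → ∃ h₀ : NNReal, 0 < h₀ ∧ ∀ h : NNReal, 0 < h → h ≤ h₀ →
        Literature.MathematicalPhysics.QuantumManyBody.BoseGas.condensateNumber
            (v + Set.indicator (Set.Iic R) (fun _ : ℝ => (((t + h : NNReal)) : ENNReal))) N L ≤
          Literature.MathematicalPhysics.QuantumManyBody.BoseGas.condensateNumber
            (v + Set.indicator (Set.Iic R) (fun _ : ℝ => (t : ENNReal))) N L + ((ε * h : NNReal) : ENNReal)

/-- Statement of v5's stub `stub_covarianceSign` (verbatim; in v6 a consequence of the three stubs). -/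
abbrev stub_covarianceSign : Prop :=
  ∀ (v : ℝ → ENNReal) (R : ℝ), Measurable v → 0 < R → (∀ r : ℝ, R < r → v r = 0) →
    ∃ η₀ : ℝ, 0 < η₀ ∧ ∀ (N : ℕ) (L : ℝ), (N : ℝ) * R ^ 3 ≤ η₀ * L ^ 3 →
      ∀ s t : NNReal, s ≤ t →
        Literature.MathematicalPhysics.QuantumManyBody.BoseGas.condensateNumber
            (v + Set.indicator (Set.Iic R) (fun _ : ℝ => (t : ENNReal))) N L ≤
          Literature.MathematicalPhysics.QuantumManyBody.BoseGas.condensateNumber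
            (v + Set.indicator (Set.Iic R) (fun _ : ℝ => (s : ENNReal))) N L

end Goal

/-! ## The registered open stub `stub_diniSign` (XL) — the only `sorry`; `stub_localToGlobal` (p155546), `stub_pathLsc` (p154150),
`stub_diniGlue` (p154590), `stub_continuityAtHardCore` (p151033) are imported theorems -/

/-- **stub — DiniSign (the covariance sign, infinitesimal form; XL).** For every measurable radial profile
`v` vanishing beyond `R > 0` there is a dilute window `N·R³ ≤ η₀·L³` in which, at EVERY finite coupling `t`,
the upper-right Dini derivative of `h ↦ cn(v_{t+h})` at `h = 0` is `≤ 0`: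
`∀ ε > 0 ∃ h₀ > 0 ∀ 0 < h ≤ h₀, cn(v_{t+h}) ≤ cn(v_t) + ε h`. Intended mechanism: first-order perturbation of
the ground state `Ψ_t` of `v_t` by the core overlap `W_R`, `d/dt λ_max(γ_t) = -2⟨n̂_φ Ψ_t, R_⊥ W_R Ψ_t⟩`
(`φ` the top mode, `R_⊥` the reduced resolvent), i.e. a non-negative static response of the condensate
occupation to the core overlap — the route's covariance-sign bet, uniform in `N` in the window. -/
theorem stub_diniSign :
    ∀ (v : ℝ → ENNReal) (R : ℝ), Measurable v → 0 < R → (∀ r : ℝ, R < r → v r = 0) →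
      ∃ η₀ : ℝ, 0 < η₀ ∧ ∀ (N : ℕ) (L : ℝ), (N : ℝ) * R ^ 3 ≤ η₀ * L ^ 3 →
        ∀ (t : NNReal) (ε : NNReal), 0 < ε → ∃ h₀ : NNReal, 0 < h₀ ∧ ∀ h : NNReal, 0 < h → h ≤ h₀ →
          Literature.MathematicalPhysics.QuantumManyBody.BoseGas.condensateNumber
              (v + Set.indicator (Set.Iic R) (fun _ : ℝ => (((t + h : NNReal)) : ENNReal))) N L ≤
            Literature.MathematicalPhysics.QuantumManyBody.BoseGas.condensateNumber
              (v + Set.indicator (Set.Iic R) (fun _ : ℝ => (t : ENNReal))) N L +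
              ((ε * h : NNReal) : ENNReal) := by
  sorry

/-! ## The composition step, POINTWISE in `(v, R, N, L)` — registered stub `stub_condensateNumber_hardSphere_le_of_dini`,
LANDED p157832 (`Theorems/BECHardSphereReductionHardCoreDominatesOfDiniSign.lean`, imported above): for a measurable radial `v`
vanishing beyond `R > 0` and ANY `(N, L)`, the Dini sign of `t ↦ cn(v_t)` at that `(N, L)` alone gives
`condensateNumber HS_R N L ≤ condensateNumber v N L` (window-free, guard-free; from `pathDominated_of_dini` p155546 and
`condensateNumber_hardSphere_le_liminf` p151033). With it the file also lands `hardCoreDominates_of_diniSign` (the crux BY NAME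
from the registered stub's statement, window for window), `hardCoreDominates_of_pathDominated`, `…_of_frequentlyDominated`. -/

/-! ## Composition (sorry-free): v5's stub from the Dini sign (documentation), then the crux BY NAME -/

/-- **v5's `stub_covarianceSign` from the Dini sign**: inside the window of `stub_diniSign` apply the window-free
local-to-global stub `stub_localToGlobal` at each `(N, L)`. [folklore] -/
theorem covarianceSign_of_dini (hD : Goal.stub_diniSign) : Goal.stub_covarianceSign := by
  intro v R hmeas hR hvR
  obtain ⟨η₀, hη₀, hdini⟩ := hD v R hmeas hR hvR
  exact ⟨η₀, hη₀, fun N L hNL s t hst => stub_localToGlobal v R N L (hdini N L hNL) s t hst⟩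

/-- **Assembly of the line**: the Dini-form covariance sign (hypothesis, by its audit name) supplies, in its own window,
the hypothesis of the landed pointwise composition `stub_condensateNumber_hardSphere_le_of_dini` at each `(N, L)`
(packaged as `hardCoreDominates_of_diniSign`, p157832); the window of the crux is that window. [folklore] -/
theorem HardCoreDominates_of (hD : Goal.stub_diniSign) :
    Summit.AtomisticToContinuum.BoseEinsteinCondensation.Theses.BECHardSphereReduction.HardCoreDominates :=
  hardCoreDominates_of_diniSign hD

/-- **The skeleton applied to the stub**: `HardCoreDominates` modulo exactly the one sorried stub of this file,
`stub_diniSign`; everything else in its cone is landed (p143761 p144560 p146938 p147861 p149338 p151033 p154150 p154590 p155546 p157832). -/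
theorem HardCoreDominates_proof :
    Summit.AtomisticToContinuum.BoseEinsteinCondensation.Theses.BECHardSphereReduction.HardCoreDominates :=
  HardCoreDominates_of stub_diniSign

end Summit.AtomisticToContinuum.BoseEinsteinCondensation.Cruxes.HardCoreDominates.Birth
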